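import Summits.BirchSwinnertonDyer.BirchSwinnertonDyer.Theorems.Rank2Observatory2DescClSplitImageClass
import HarnessLib

/-!
# BirchSwinnertonDyer — rank ≥ 2 observatory: KERNEL-2DESC-CL — SOUNDNESS OF THE SPLIT LOCAL IMAGE TREE (M3b part 2, odd `ℓ`)

HONEST FRAMING: per-curve certified theorems and census instruments; no claim on BSD in rank ≥ 2.

Main theorem `vecOdd_mem_splitImgOdd`: for an odd prime `ℓ`, a square-class map `S : SqClassMapOdd ℓ` (part 1,
`…SplitImageClass`), roots `e₀, e₁, e₂ ∈ ℤ_ℓ` congruent to pairwise distinct integers `ē_i` modulo `ℓ^K`, `K = D + 1`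
(`D = nodeDepth ℓ ē`), and ANY `x, y ∈ ℚ_ℓ`, `y ≠ 0`, with `y² = (x − e₀)(x − e₁)(x − e₂)`, the class vector
`(S.cls (x − e_i))_i` (6-bit mask `vecOdd`) is a member of the computable list `splitImgOdd ℓ ē` of M3a (`…SplitImageTree`).

Proof: the digits `r_j = x mod ℓ^j` (`PadicInt.appr`) walk down the tree (`levelsOdd_sound`, induction on the fuel;
`childrenOdd`/`accOdd`/`nextOdd` unfold one level); at a LEAF every `w_i = r_j − ē_i` has `v(w_i) < j`, so `x − e_i ∈
w_i + ℓ^j ℤ_ℓ` has the class of `w_i` and the product class is trivial because `∏ (x − e_i) = y²`; at the TERMINAL level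
`j = K` at most one root is undetermined (`ℓ^K ∤ ē_i − ē_k`), its class is one of the four and the square condition
filters it — exactly `termOdd` (`nodeOdd_sound`); a pole `x ∉ ℤ_ℓ` gives three equal classes whose XOR vanishes, hence the
zero vector (`vecOdd_eq_zero_of_pole`).  Completeness of the tree is not claimed and not needed by the rows.

Sorry-free; axioms `propext`, `Classical.choice`, `Quot.sound`.
[cite: Cassels1991LecturesEllipticCurves, §15] [cite: Cohen1993, §1.4.2]
-/

set_option linter.dupNamespace false
set_option autoImplicit false

namespace Summit.BirchSwinnertonDyer.BirchSwinnertonDyer.Rank2Observatory.TwoDescCl.SplitImage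

/-! ## §5 Soundness of a node, of the level recursion, and of the whole tree -/

section Sound
variable {ℓ : ℕ} [hp : Fact ℓ.Prime]

/-- **Node soundness**: whatever `nodeOdd` accepts at the residue `x mod ℓ^j` contains the point's vector.
[cite: Cassels1991LecturesEllipticCurves, §15] -/
theorem nodeOdd_sound (S : SqClassMapOdd ℓ) (hℓ : ℓ ≠ 2) {e : Fin 3 → ℤ_[ℓ]} {ē : Fin 3 → ℤ} {K : ℕ}
    (hK : K = nodeDepth ℓ ē + 1) (hdist : ∀ i k : Fin 3, i ≠ k → ē i ≠ ē k)
    (happ : ∀ i, ∃ t : ℤ_[ℓ], e i = (ē i : ℤ_[ℓ]) + (ℓ : ℤ_[ℓ]) ^ K * t)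
    (X : ℤ_[ℓ]) {y : ℚ_[ℓ]} (hy : y ≠ 0)
    (hcurve : y ^ 2 = ((X : ℚ_[ℓ]) - e 0) * ((X : ℚ_[ℓ]) - e 1) * ((X : ℚ_[ℓ]) - e 2))
    {j : ℕ} (hj : j ≤ K) {vs : List ℕ} (hnode : nodeOdd ℓ K ē j ((X.appr j : ℕ) : ℤ) = some vs) :
    vecOdd S X e ∈ vs := by
  have hsq := xor3_of_sq S hy hcurve
  have hok : sqOkOdd (vecOdd S X e) = true := by
    unfold vecOdd; rw [sqOkOdd_vec3]; simp [hsq.1, hsq.2]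
  obtain ⟨t, ht⟩ := exists_appr_add X j
  -- every `x − e_i` is `(r − ē_i) + ℓ^j T_i`
  have hz : ∀ i, ∃ T : ℤ_[ℓ], (X : ℚ_[ℓ]) - e i =
      ((((X.appr j : ℕ) : ℤ) - ē i : ℤ) : ℚ_[ℓ]) + (ℓ : ℚ_[ℓ]) ^ j * (T : ℚ_[ℓ]) := by
    intro i
    obtain ⟨tᵢ, htᵢ⟩ := happ i
    obtain ⟨d, hd⟩ := Nat.exists_eq_add_of_le hj
    refine ⟨t - (ℓ : ℤ_[ℓ]) ^ d * tᵢ, ?_⟩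
    have hXe : X - e i = ((((X.appr j : ℕ) : ℤ) - ē i : ℤ) : ℤ_[ℓ]) +
        (ℓ : ℤ_[ℓ]) ^ j * (t - (ℓ : ℤ_[ℓ]) ^ d * tᵢ) := by
      calc X - e i = (((X.appr j : ℕ) : ℤ_[ℓ]) + (ℓ : ℤ_[ℓ]) ^ j * t) -
            ((ē i : ℤ_[ℓ]) + (ℓ : ℤ_[ℓ]) ^ K * tᵢ) := by rw [← ht, ← htᵢ]
        _ = _ := by rw [hd]; push_cast; ring
    have := congrArg (fun z : ℤ_[ℓ] => (z : ℚ_[ℓ])) hXe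
    simpa only [PadicInt.coe_sub, PadicInt.coe_add, PadicInt.coe_mul, PadicInt.coe_pow,
      PadicInt.coe_natCast, PadicInt.coe_intCast] using this
  -- a determined root contributes exactly `bitsOdd`
  have hleaf : ∀ i : Fin 3, leafOdd ℓ ē j ((X.appr j : ℕ) : ℤ) i = true →
      bitsOdd ℓ i.val (((X.appr j : ℕ) : ℤ) - ē i) =
        mkOdd i.val (S.cls ((X : ℚ_[ℓ]) - e i)).1 (S.cls ((X : ℚ_[ℓ]) - e i)).2 := by
    intro i hi
    rw [leafOdd_eq_true_iff] at hi
    obtain ⟨T, hT⟩ := hz i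
    rw [bitsOdd, cls_eq_of_approx S hℓ T hi.1 hi.2 hT]
  unfold nodeOdd at hnode
  by_cases hall : (leafOdd ℓ ē j ((X.appr j : ℕ) : ℤ) 0 && leafOdd ℓ ē j ((X.appr j : ℕ) : ℤ) 1 &&
      leafOdd ℓ ē j ((X.appr j : ℕ) : ℤ) 2) = true
  · -- a leaf
    rw [if_pos hall] at hnode
    simp only [Bool.and_eq_true] at hall
    have hbv := bvOdd_eq_vec3 ē ((X.appr j : ℕ) : ℤ) (fun i => S.cls ((X : ℚ_[ℓ]) - e i))
      (fun k => hleaf k (by fin_cases k <;> simp [hall]))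
    have hv : bvOdd ℓ ē ((X.appr j : ℕ) : ℤ) = vecOdd S X e := hbv
    rw [hv, hok] at hnode
    simp only [↓reduceIte, Option.some.injEq] at hnode
    rw [← hnode]; exact List.mem_singleton_self _
  · rw [if_neg hall] at hnode
    by_cases hjK : j < K
    · rw [if_pos hjK] at hnode; exact absurd hnode (by simp)
    · -- the terminal level
      rw [if_neg hjK] at hnode
      have hjK' : j = K := le_antisymm hj (not_lt.mp hjK)
      subst hjK'
      have hi₀ : leafOdd ℓ ē j ((X.appr j : ℕ) : ℤ) (matchOdd ℓ ē j ((X.appr j : ℕ) : ℤ)) = false :=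
        leafOdd_matchOdd hall
      have hothers : ∀ k, k ≠ matchOdd ℓ ē j ((X.appr j : ℕ) : ℤ) →
          leafOdd ℓ ē j ((X.appr j : ℕ) : ℤ) k = true := fun k hk =>
        leafOdd_of_leafOdd_false hK (Ne.symm hk) (hdist _ _ (Ne.symm hk)) hi₀
      have hb := baseOdd_add_mkOdd ē ((X.appr j : ℕ) : ℤ) (matchOdd ℓ ē j ((X.appr j : ℕ) : ℤ))
        (fun i => S.cls ((X : ℚ_[ℓ]) - e i)) (fun k hk => hleaf k (hothers k hk))
      have hb' : baseOdd ℓ ē ((X.appr j : ℕ) : ℤ) (matchOdd ℓ ē j ((X.appr j : ℕ) : ℤ)) +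
          mkOdd (matchOdd ℓ ē j ((X.appr j : ℕ) : ℤ)).val
            (S.cls ((X : ℚ_[ℓ]) - e (matchOdd ℓ ē j ((X.appr j : ℕ) : ℤ)))).1
            (S.cls ((X : ℚ_[ℓ]) - e (matchOdd ℓ ē j ((X.appr j : ℕ) : ℤ)))).2 = vecOdd S X e := hb
      simp only [Option.some.injEq] at hnode
      rw [← hnode, termOdd, List.mem_filterMap]
      exact ⟨S.cls ((X : ℚ_[ℓ]) - e (matchOdd ℓ ē j ((X.appr j : ℕ) : ℤ))), mem_fourClasses _,
        by simp only [hb', hok, ↓reduceIte]⟩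

/-! ### The level recursion, unfolded -/

/-- The children of the live residues at level `j`. [folklore] -/
def childrenOdd (ℓ : ℕ) (j : ℕ) (live : List ℤ) : List ℤ :=
  live.flatMap fun r0 => (List.range ℓ).map fun (a : ℕ) => r0 + (a : ℤ) * (ℓ : ℤ) ^ (j - 1)

/-- One level: (residue, node verdict). [folklore] -/
def stepOdd (ℓ K : ℕ) (e : Fin 3 → ℤ) (j : ℕ) (live : List ℤ) : List (ℤ × Option (List ℕ)) :=
  (childrenOdd ℓ j live).map fun r => (r, nodeOdd ℓ K e j r)

/-- The vectors accepted at level `j`. [folklore] -/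
def accOdd (ℓ K : ℕ) (e : Fin 3 → ℤ) (j : ℕ) (live : List ℤ) : List ℕ :=
  (stepOdd ℓ K e j live).flatMap fun p => p.2.getD []

/-- The residues refined further. [folklore] -/
def nextOdd (ℓ K : ℕ) (e : Fin 3 → ℤ) (j : ℕ) (live : List ℤ) : List ℤ :=
  (stepOdd ℓ K e j live).filterMap fun p => if p.2.isNone then some p.1 else none

/-- One unfolding step of the level recursion `levelsOdd` in terms of `accOdd` / `nextOdd`. [folklore] -/
theorem levelsOdd_succ (ℓ K : ℕ) (e : Fin 3 → ℤ) (fuel j : ℕ) (live : List ℤ) :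
    levelsOdd ℓ K e (fuel + 1) j live =
      accOdd ℓ K e j live ++
        (if (nextOdd ℓ K e j live).isEmpty then [] else levelsOdd ℓ K e fuel (j + 1) (nextOdd ℓ K e j live)) :=
  rfl

omit hp in
/-- A mask emitted by a decided child node at level `j` belongs to `accOdd`. [folklore] -/
theorem mem_accOdd {K : ℕ} {e : Fin 3 → ℤ} {j : ℕ} {live : List ℤ} {r : ℤ} {vs : List ℕ} {v : ℕ}
    (hr : r ∈ childrenOdd ℓ j live) (hnode : nodeOdd ℓ K e j r = some vs) (hv : v ∈ vs) :
    v ∈ accOdd ℓ K e j live := by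
  rw [accOdd, List.mem_flatMap]
  exact ⟨(r, nodeOdd ℓ K e j r), List.mem_map.mpr ⟨r, hr, rfl⟩, by simpa [hnode] using hv⟩

omit hp in
/-- An undecided child residue at level `j` is passed to the next level (`nextOdd`). [folklore] -/
theorem mem_nextOdd {K : ℕ} {e : Fin 3 → ℤ} {j : ℕ} {live : List ℤ} {r : ℤ}
    (hr : r ∈ childrenOdd ℓ j live) (hnode : nodeOdd ℓ K e j r = none) : r ∈ nextOdd ℓ K e j live := by
  rw [nextOdd, List.mem_filterMap]
  exact ⟨(r, nodeOdd ℓ K e j r), List.mem_map.mpr ⟨r, hr, rfl⟩, by simp [hnode]⟩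

/-- The digit `x mod ℓ^j` is a child of `x mod ℓ^{j-1}`. [folklore] -/
theorem appr_mem_childrenOdd (X : ℤ_[ℓ]) {j : ℕ} (hj : 1 ≤ j) {live : List ℤ}
    (hlive : ((X.appr (j - 1) : ℕ) : ℤ) ∈ live) : ((X.appr j : ℕ) : ℤ) ∈ childrenOdd ℓ j live := by
  obtain ⟨a, ha, hsucc⟩ := appr_succ X (j - 1)
  rw [Nat.sub_add_cancel hj] at hsucc
  rw [childrenOdd, List.mem_flatMap]
  refine ⟨((X.appr (j - 1) : ℕ) : ℤ), hlive, List.mem_map.mpr ⟨a, List.mem_range.mpr ha, ?_⟩⟩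
  rw [hsucc]; push_cast; ring

/-- **Level soundness** (induction on the fuel): the walk of digits of `x` reaches an accepting node.
[cite: Cassels1991LecturesEllipticCurves, §15] -/
theorem levelsOdd_sound (S : SqClassMapOdd ℓ) (hℓ : ℓ ≠ 2) {e : Fin 3 → ℤ_[ℓ]} {ē : Fin 3 → ℤ} {K : ℕ}
    (hK : K = nodeDepth ℓ ē + 1) (hdist : ∀ i k : Fin 3, i ≠ k → ē i ≠ ē k)
    (happ : ∀ i, ∃ t : ℤ_[ℓ], e i = (ē i : ℤ_[ℓ]) + (ℓ : ℤ_[ℓ]) ^ K * t)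
    (X : ℤ_[ℓ]) {y : ℚ_[ℓ]} (hy : y ≠ 0)
    (hcurve : y ^ 2 = ((X : ℚ_[ℓ]) - e 0) * ((X : ℚ_[ℓ]) - e 1) * ((X : ℚ_[ℓ]) - e 2)) :
    ∀ (fuel j : ℕ) (live : List ℤ), 1 ≤ j → j ≤ K → K + 1 ≤ fuel + j →
      ((X.appr (j - 1) : ℕ) : ℤ) ∈ live → vecOdd S X e ∈ levelsOdd ℓ K ē fuel j live := by
  intro fuel
  induction fuel with
  | zero => intro j live hj hjK hfuel _; omega
  | succ fuel ih =>
    intro j live hj hjK hfuel hlive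
    have hchild := appr_mem_childrenOdd X hj hlive
    rw [levelsOdd_succ, List.mem_append]
    rcases hnode : nodeOdd ℓ K ē j ((X.appr j : ℕ) : ℤ) with _ | vs
    · right
      have hjK' : j < K := nodeOdd_eq_none hnode
      have hnext := mem_nextOdd hchild hnode
      have hne : (nextOdd ℓ K ē j live).isEmpty = false :=
        List.isEmpty_eq_false_iff_exists_mem.mpr ⟨_, hnext⟩
      rw [hne, if_neg Bool.false_ne_true]
      exact ih (j + 1) _ (by omega) (by omega) (by omega) (by simpa using hnext)
    · left
      exact mem_accOdd hchild hnode (nodeOdd_sound S hℓ hK hdist happ X hy hcurve hjK hnode)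

/-- **Poles**: if `x ∉ ℤ_ℓ` the three classes coincide, so the square condition forces the zero vector.
[cite: Cassels1991LecturesEllipticCurves, §15] -/
theorem vecOdd_eq_zero_of_pole (S : SqClassMapOdd ℓ) (e : Fin 3 → ℤ_[ℓ]) {x y : ℚ_[ℓ]} (hx : ¬ ‖x‖ ≤ 1)
    (hy : y ≠ 0) (hcurve : y ^ 2 = (x - e 0) * (x - e 1) * (x - e 2)) : vecOdd S x e = 0 := by
  have hx0 : x ≠ 0 := by rintro rfl; simp at hx
  have hℓ0 : (ℓ : ℚ_[ℓ]) ≠ 0 := Nat.cast_ne_zero.mpr hp.out.ne_zero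
  have hv : x.valuation < 0 := by rw [Padic.norm_le_one_iff_val_nonneg] at hx; omega
  obtain ⟨m, hm⟩ : ∃ m : ℕ, (m : ℤ) = -x.valuation := ⟨(-x.valuation).toNat, Int.toNat_of_nonneg (by omega)⟩
  have hm1 : 1 ≤ m := by omega
  -- `X = ℓ^m x` is a unit of `ℤ_ℓ`
  set X : ℚ_[ℓ] := x * (ℓ : ℚ_[ℓ]) ^ m with hXdef
  have hX0 : X ≠ 0 := mul_ne_zero hx0 (pow_ne_zero _ hℓ0)
  have hXv : X.valuation = 0 := by
    rw [hXdef, Padic.valuation_mul hx0 (pow_ne_zero _ hℓ0), Padic.valuation_pow, Padic.valuation_p]; omega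
  have hXn : ‖X‖ = 1 := by rw [Padic.norm_eq_zpow_neg_valuation hX0, hXv]; simp
  set Xz : ℤ_[ℓ] := ⟨X, hXn.le⟩ with hXz
  obtain ⟨t, ht⟩ := exists_appr_add Xz 1
  have ha_lt : Xz.appr 1 < ℓ := by simpa using PadicInt.appr_lt Xz 1
  have hXq : X = ((Xz.appr 1 : ℕ) : ℚ_[ℓ]) + (ℓ : ℚ_[ℓ]) ^ 1 * (t : ℚ_[ℓ]) := by
    have := congrArg (fun z : ℤ_[ℓ] => (z : ℚ_[ℓ])) ht
    simpa only [PadicInt.coe_add, PadicInt.coe_mul, PadicInt.coe_pow, PadicInt.coe_natCast] using this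
  have ha0 : Xz.appr 1 ≠ 0 := by
    intro h0
    rw [h0, Nat.cast_zero, zero_add, pow_one] at hXq
    have ht1 : ‖(t : ℚ_[ℓ])‖ ≤ 1 := t.2
    have hl : (ℓ : ℝ)⁻¹ < 1 := inv_lt_one_of_one_lt₀ (by exact_mod_cast hp.out.one_lt)
    have : ‖X‖ < 1 := by
      rw [hXq, norm_mul, Padic.norm_p]
      calc (ℓ : ℝ)⁻¹ * ‖(t : ℚ_[ℓ])‖ ≤ (ℓ : ℝ)⁻¹ * 1 := by gcongr
        _ < 1 := by rw [mul_one]; exact hl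
    rw [hXn] at this; exact lt_irrefl _ this
  have hva : padicValInt ℓ ((Xz.appr 1 : ℕ) : ℤ) = 0 := by
    apply padicValInt.eq_zero_of_not_dvd
    intro h
    have := Nat.le_of_dvd (Nat.pos_of_ne_zero ha0) (Int.natCast_dvd_natCast.mp h)
    omega
  -- the three `X − ℓ^m e_i` share the residue `a = X mod ℓ`
  have hcl : ∀ i, S.cls (X - (ℓ : ℚ_[ℓ]) ^ m * (e i : ℚ_[ℓ])) =
      (false, decide (legendreSym ℓ ((Xz.appr 1 : ℕ) : ℤ) = -1)) := by
    intro i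
    obtain ⟨m', hm'⟩ : ∃ m', m = m' + 1 := ⟨m - 1, by omega⟩
    have hz : X - (ℓ : ℚ_[ℓ]) ^ m * (e i : ℚ_[ℓ]) = (((Xz.appr 1 : ℕ) : ℤ) : ℚ_[ℓ]) +
        (ℓ : ℚ_[ℓ]) ^ 1 * ((t - (ℓ : ℤ_[ℓ]) ^ m' * e i : ℤ_[ℓ]) : ℚ_[ℓ]) := by
      rw [hXq, hm']; push_cast; ring
    have h1 := S.cls_approx _ _ 1 _ (by exact_mod_cast ha0) (by rw [hva]; exact Nat.one_pos) hz
    rw [h1, hva]; simp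
  -- `x − e_i = (X − ℓ^m e_i) · ℓ^{-m}`
  have hfac : ∀ i, x - (e i : ℚ_[ℓ]) = (X - (ℓ : ℚ_[ℓ]) ^ m * (e i : ℚ_[ℓ])) * ((ℓ : ℚ_[ℓ]) ^ m)⁻¹ := by
    intro i
    rw [eq_mul_inv_iff_mul_eq₀ (pow_ne_zero _ hℓ0), hXdef]; ring
  obtain ⟨h0, h1, h2⟩ := ne_zero_of_sq hy hcurve
  have hxe : ∀ i, x - (e i : ℚ_[ℓ]) ≠ 0 := by intro i; fin_cases i <;> assumption
  have hXe : ∀ i, X - (ℓ : ℚ_[ℓ]) ^ m * (e i : ℚ_[ℓ]) ≠ 0 := by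
    intro i h; exact hxe i (by rw [hfac i, h, zero_mul])
  have hinv : ((ℓ : ℚ_[ℓ]) ^ m)⁻¹ ≠ 0 := inv_ne_zero (pow_ne_zero _ hℓ0)
  have hc : ∀ i, S.cls (x - (e i : ℚ_[ℓ])) =
      (false != (S.cls ((ℓ : ℚ_[ℓ]) ^ m)⁻¹).1,
        decide (legendreSym ℓ ((Xz.appr 1 : ℕ) : ℤ) = -1) != (S.cls ((ℓ : ℚ_[ℓ]) ^ m)⁻¹).2) := by
    intro i; rw [hfac i, S.cls_mul _ _ (hXe i) hinv, hcl i]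
  have hsq := xor3_of_sq S hy hcurve
  rw [hc 0, hc 1, hc 2] at hsq
  unfold vecOdd
  rw [hc 0, hc 1, hc 2]
  generalize S.cls ((ℓ : ℚ_[ℓ]) ^ m)⁻¹ = d at hsq ⊢
  generalize decide (legendreSym ℓ ((Xz.appr 1 : ℕ) : ℤ) = -1) = b at hsq ⊢
  obtain ⟨d1, d2⟩ := d
  revert hsq
  cases d1 <;> cases d2 <;> cases b <;> decide

/-- **SOUNDNESS OF THE SPLIT LOCAL IMAGE TREE (odd `ℓ`)**.  For an odd prime `ℓ`, a square-class map `S`,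
roots `e_i ∈ ℤ_ℓ` with `e_i ≡ ē_i (mod ℓ^{D+1})` for pairwise distinct integers `ē_i`
(`D = nodeDepth ℓ ē`), and any `x, y ∈ ℚ_ℓ`, `y ≠ 0`, with `y² = (x − e₀)(x − e₁)(x − e₂)`: the class vector
`(cls (x − e_i))_i` lies in `splitImgOdd ℓ ē`. [cite: Cassels1991LecturesEllipticCurves, §15] -/
theorem vecOdd_mem_splitImgOdd (S : SqClassMapOdd ℓ) (hℓ : ℓ ≠ 2) {e : Fin 3 → ℤ_[ℓ]} {ē : Fin 3 → ℤ}
    (hdist : ∀ i k : Fin 3, i ≠ k → ē i ≠ ē k)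
    (happ : ∀ i, ∃ t : ℤ_[ℓ], e i = (ē i : ℤ_[ℓ]) + (ℓ : ℤ_[ℓ]) ^ (nodeDepth ℓ ē + 1) * t)
    {x y : ℚ_[ℓ]} (hy : y ≠ 0) (hcurve : y ^ 2 = (x - e 0) * (x - e 1) * (x - e 2)) :
    vecOdd S x e ∈ splitImgOdd ℓ ē := by
  unfold splitImgOdd
  rw [List.mem_dedup]
  by_cases hx : ‖x‖ ≤ 1
  · apply List.mem_cons_of_mem
    set X : ℤ_[ℓ] := ⟨x, hx⟩ with hX
    have hxX : x = (X : ℚ_[ℓ]) := rfl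
    rw [hxX] at hcurve ⊢
    have h0 : ((X.appr (1 - 1) : ℕ) : ℤ) ∈ [0] := by
      simp [show X.appr 0 = 0 from rfl]
    exact levelsOdd_sound S hℓ rfl hdist happ X hy hcurve (nodeDepth ℓ ē + 1 + 1) 1 [0] le_rfl
      (by omega) (by omega) h0
  · rw [vecOdd_eq_zero_of_pole S e hx hy hcurve]
    exact List.mem_cons_self

end Sound

end Summit.BirchSwinnertonDyer.BirchSwinnertonDyer.Rank2Observatory.TwoDescCl.SplitImage
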